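import Literature.Computability.AlgebraicComplexity.BI17FundamentalInvariantForms
import Literature.Computability.AlgebraicComplexity.PolystabilityProofs
import HarnessLib

/-!
# `X₁⋯X_m` and the power sums `X₁^D + ⋯ + X_m^D` (`D > 1`) are polystable
# (Bürgisser–Ikenmeyer 2017, Cor. 2.9, remaining clauses): discharge

Sibling proof file of `Literature/Computability/AlgebraicComplexity/BI17FundamentalInvariantForms.lean`
(cell `val-lit`, DAG row BI17-A), discharging its named fact
`Literature.Computability.AlgebraicComplexity.BI2017_cor_2_9_chow_powerSum`:

* for every `m`, the monomial `X₁⋯X_m ∈ Sym^m ℂ^m` is polystable (its `SL_m(ℂ)`-orbit under linear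
  substitution is Zariski closed in coefficient space, `IsPolystable`), and
* for every `m` and every `D > 1`, the power sum `X₁^D + ⋯ + X_m^D ∈ Sym^D ℂ^m` is polystable

(P. Bürgisser, C. Ikenmeyer, *Fundamental invariants of orbit closures*, J. Algebra 477 (2017)
390–434, Cor. 2.9: "The forms `X₁⋯X_m`, `X₁^D + ⋯ + X_m^D` if `D > 1`, `det_n`, and `per_n` are all
polystable"; arXiv:1511.02927 TeX L611, held text `paper:arxiv-1511.02927` p0007.txt:L41–57 with the
printed proof). The `det_n`/`per_n` clauses are the tree's
`BurgisserIkenmeyer2017_polystable_det_per_holds` (`PolystabilityProofs.lean`).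

## Proof

The printed proof applies Prop. 2.8 (Hilbert–Mumford as refined by Luna/Kempf: a destabilising
one-parameter subgroup may be taken in the centraliser of a reductive subgroup `R` of the stabiliser)
with `R` the diagonal torus of `SL_m` (for `X₁⋯X_m`), resp. the diagonal matrices with `D`-th roots
of unity (for the power sum), and then checks that `(1,…,1)` lies in the cone spanned by the support.
As for `det_n`/`per_n` in `PolystabilityProofs.lean`, we replace the GIT inputs (absent from Mathlib)
by the tree's **Kempf–Ness route** `isPolystable_tensorToPoly_of_momentMatrix_eq_smul_one`: a form
that is the polynomial shadow `tensorToPoly T` of a SYMMETRIC tensor `T : (Fin n → σ) → ℂ` whose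
moment matrix (`momentMatrix`, `TensorMomentMatrix.lean`) is SCALAR is polystable.

* `X₁⋯X_m = tensorToPoly (chowTensor m)` with `chowTensor m j = (m!)⁻¹ ∑_{τ ∈ 𝔖_m} [j = τ]`
  (`tensorToPoly_chowTensor`), and `∑_i X_i^D = tensorToPoly (powerSumTensor m D)` with
  `powerSumTensor m D j = ∑_i [j = (i,…,i)]` (`tensorToPoly_powerSumTensor`).
* A general criterion for a scalar moment matrix replacing the explicit count done for pattern
  tensors in `TensorMomentMatrix.lean` (`exists_momentMatrix_eq_smul_one_of_rigid_of_relabel`): if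
  (i) the support of `T` is RIGID — no two words of the support differ in exactly one slot — then
  the off-diagonal entries of `momentMatrix T` vanish (`momentMatrix_apply_eq_zero_of_rigid`), and
  if (ii) `T` is invariant under relabelling the alphabet `σ` by permutations, then all diagonal
  entries agree (`momentMatrix_apply_relabel`, transport by a transposition). Both tensors are rigid
  (two permutations, resp. two constant words of length `D ≥ 2`, agreeing off one slot agree — this
  is where `D > 1` enters: the linear form `X₁ + ⋯ + X_m`, `m ≥ 2`, is NOT polystable) and
  relabelling-invariant, and symmetric in the slots; hence polystable
  (`isPolystable_tensorToPoly_of_rigid_of_relabel`).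

The support condition is the moment-map form of the printed cone condition: the torus weights of
the support words of `X₁⋯X_m` (all permutations) and of `∑ X_i^D` (the words `(i,…,i)`) sum to a
multiple of `(1,…,1)`.

## What this file declares

Definitions `chowTensor`, `powerSumTensor` (the two symmetric tensors; [folklore] plumbing); public
theorems `tensorToPoly_chowTensor`, `tensorToPoly_powerSumTensor`,
`exists_momentMatrix_eq_smul_one_of_rigid_of_relabel`, `isPolystable_tensorToPoly_of_rigid_of_relabel`
(intermediate steps of OUR proof, tagged to the statement they serve), `isPolystable_prod_X`,
`isPolystable_sum_X_pow` and the discharge `BI2017_cor_2_9_chow_powerSum_holds`; the remaining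
helpers are `private`. Everything is proved; no named facts, no `instance`, no `notation`.

## References

* [BurgisserIkenmeyer2017] P. Bürgisser, C. Ikenmeyer, *Fundamental invariants of orbit closures*,
  J. Algebra 477 (2017) 390–434 = arXiv:1511.02927, §2.2, Def. 2.7, Prop. 2.8, Cor. 2.9 (TeX L611;
  held text `paper:arxiv-1511.02927` p0007:L39).
* G. Kempf, L. Ness, *The length of vectors in representation spaces*, LNM 732 (1979), Thm. 0.1,
  Thm. 0.2 (the route of `PolystabilityProofs.lean`).
-/

noncomputable section

open MvPolynomial Finset

namespace Literature.Computability.AlgebraicComplexity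

/-! ### A support criterion for a scalar moment matrix -/

section Criterion

variable {σ : Type*} [Fintype σ] [DecidableEq σ] {n : ℕ}

/-- **Rigid support ⇒ off-diagonal moment entries vanish.** If no two words in the support of `S`
differ in exactly one slot (changing slot `k` of a support word `j` to a letter `b` stays in the
support only for `b = j k`), then `momentMatrix S a b = 0` for `a ≠ b`. (The pattern-tensor case is
`momentMatrix_patternTensor_apply_of_ne`.) [folklore] -/
private theorem momentMatrix_apply_eq_zero_of_rigid (S : (Fin n → σ) → ℂ)
    (hrigid : ∀ (j : Fin n → σ) (k : Fin n) (b : σ),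
      S j ≠ 0 → S (Function.update j k b) ≠ 0 → b = j k)
    {a b : σ} (hab : a ≠ b) : momentMatrix S a b = 0 := by
  rw [momentMatrix_apply]
  refine Finset.sum_eq_zero fun k _ => Finset.sum_eq_zero fun j _ => ?_
  by_cases hjk : j k = a
  · rw [if_pos hjk]
    by_cases hS : S j = 0
    · rw [hS, mul_zero]
    by_cases hS' : S (Function.update j k b) = 0
    · rw [hS', map_zero, zero_mul]
    exact absurd (hjk.symm.trans (hrigid j k b hS hS').symm) hab
  · rw [if_neg hjk]

/-- **Relabelling invariance transports moment entries**: if `S (ρ ∘ j) = S j` for a permutation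
`ρ` of the alphabet, then `momentMatrix S (ρ a) (ρ b) = momentMatrix S a b` (reindex the words by
`j ↦ ρ ∘ j`). [folklore] -/
private theorem momentMatrix_apply_relabel (S : (Fin n → σ) → ℂ) (ρ : Equiv.Perm σ)
    (hrel : ∀ j : Fin n → σ, S (ρ ∘ j) = S j) (a b : σ) :
    momentMatrix S (ρ a) (ρ b) = momentMatrix S a b := by
  rw [momentMatrix_apply, momentMatrix_apply]
  refine Finset.sum_congr rfl fun k _ => ?_
  symm
  refine Fintype.sum_equiv (Equiv.piCongrRight fun _ : Fin n => ρ) _ _ fun j => ?_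
  have he : (Equiv.piCongrRight fun _ : Fin n => ρ) j = ρ ∘ j := rfl
  rw [he, ← Function.comp_update, hrel, hrel]
  have hiff : j k = a ↔ (ρ ∘ j) k = ρ a := by
    rw [Function.comp_apply]
    exact ρ.apply_eq_iff_eq.symm
  exact if_congr hiff rfl rfl

/-- **Scalar moment matrix from a rigid, relabelling-invariant support.** If the support of `S` is
rigid and `S` is invariant under all relabellings of the alphabet, then `momentMatrix S = c • 1`
(off-diagonal entries vanish; diagonal entries are permuted transitively by transpositions). This is
the moment-map ("critical point", Kempf–Ness) form of the cone condition in Bürgisser–Ikenmeyer 2017,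
Prop. 2.8(2), for supports homogeneous under coordinate permutations — OUR formulation, an
intermediate step of this file's proof of Cor. 2.9 (not a statement printed in the source).
[cite: BurgisserIkenmeyer2017, Cor. 2.9 (proof, arXiv p. 7; held p0007.txt:L44–57) — moment-map form of Prop. 2.8] -/
theorem exists_momentMatrix_eq_smul_one_of_rigid_of_relabel (S : (Fin n → σ) → ℂ)
    (hrigid : ∀ (j : Fin n → σ) (k : Fin n) (b : σ),
      S j ≠ 0 → S (Function.update j k b) ≠ 0 → b = j k)
    (hrel : ∀ (ρ : Equiv.Perm σ) (j : Fin n → σ), S (ρ ∘ j) = S j) :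
    ∃ c : ℂ, momentMatrix S = c • (1 : Matrix σ σ ℂ) := by
  by_cases hσ : Nonempty σ
  · obtain ⟨a₀⟩ := hσ
    refine ⟨momentMatrix S a₀ a₀, ?_⟩
    ext a b
    rw [Matrix.smul_apply, smul_eq_mul]
    by_cases hab : a = b
    · subst hab
      rw [Matrix.one_apply_eq, mul_one]
      have h := momentMatrix_apply_relabel S (Equiv.swap a₀ a) (hrel _) a₀ a₀
      rw [Equiv.swap_apply_left] at h
      exact h
    · rw [Matrix.one_apply_ne hab, mul_zero]
      exact momentMatrix_apply_eq_zero_of_rigid S hrigid hab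
  · refine ⟨0, ?_⟩
    ext a b
    exact absurd ⟨a⟩ hσ

/-- **Polystability from a rigid, relabelling-invariant, symmetric tensor**: the polynomial shadow
of such a tensor has Zariski-closed `SL`-orbit (the criterion above fed into the tree's Kempf–Ness
route `isPolystable_tensorToPoly_of_momentMatrix_eq_smul_one`) — OUR formulation of the test of
Prop. 2.8 as used in the proof of Cor. 2.9, an intermediate step (not printed in the source).
[cite: BurgisserIkenmeyer2017, Prop. 2.8 and Cor. 2.9 (proof, arXiv p. 7; held p0007.txt:L1–57)] -/
theorem isPolystable_tensorToPoly_of_rigid_of_relabel (S : (Fin n → σ) → ℂ)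
    (hsymm : ∀ (π : Equiv.Perm (Fin n)) (j : Fin n → σ), S (j ∘ π) = S j)
    (hrigid : ∀ (j : Fin n → σ) (k : Fin n) (b : σ),
      S j ≠ 0 → S (Function.update j k b) ≠ 0 → b = j k)
    (hrel : ∀ (ρ : Equiv.Perm σ) (j : Fin n → σ), S (ρ ∘ j) = S j) :
    IsPolystable (tensorToPoly S) := by
  obtain ⟨c, hc⟩ := exists_momentMatrix_eq_smul_one_of_rigid_of_relabel S hrigid hrel
  exact isPolystable_tensorToPoly_of_momentMatrix_eq_smul_one hsymm hc

end Criterion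

/-! ### The monomial `X₁⋯X_m` as a symmetric tensor -/

section Chow

variable {m : ℕ}

/-- The **Chow (monomial) tensor**: the symmetric `m`-tensor on `Fin m` supported on the bijective
words, `chowTensor m j = (m!)⁻¹ ∑_{τ ∈ 𝔖_m} [j = τ]`, whose polynomial shadow is `X₁⋯X_m`
(`tensorToPoly_chowTensor`). [folklore] -/
def chowTensor (m : ℕ) : (Fin m → Fin m) → ℂ :=
  fun j => (Nat.factorial m : ℂ)⁻¹ * ∑ τ : Equiv.Perm (Fin m), if j = ⇑τ then 1 else 0

/-- Unfolding `chowTensor`. [folklore] -/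
private theorem chowTensor_apply (j : Fin m → Fin m) :
    chowTensor m j = (Nat.factorial m : ℂ)⁻¹ * ∑ τ : Equiv.Perm (Fin m), if j = ⇑τ then 1 else 0 :=
  rfl

/-- A word in the support of the Chow tensor is a permutation. [folklore] -/
private theorem exists_eq_perm_of_chowTensor_ne_zero {j : Fin m → Fin m} (hj : chowTensor m j ≠ 0) :
    ∃ τ : Equiv.Perm (Fin m), j = ⇑τ := by
  by_contra h
  refine hj ?_
  rw [chowTensor_apply, Finset.sum_eq_zero fun τ _ => if_neg fun hτ => h ⟨τ, hτ⟩, mul_zero]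

/-- **The Chow tensor is symmetric** under permutations of the slots. [folklore] -/
private theorem chowTensor_comp_perm (π : Equiv.Perm (Fin m)) (j : Fin m → Fin m) :
    chowTensor m (j ∘ π) = chowTensor m j := by
  rw [chowTensor_apply, chowTensor_apply]
  congr 1
  symm
  -- reindex `τ ↦ τ * π`
  refine Fintype.sum_equiv (Equiv.mulRight π) _ _ fun τ => ?_
  have hiff : j = ⇑τ ↔ j ∘ π = ⇑(Equiv.mulRight π τ) := by
    rw [Equiv.coe_mulRight, Equiv.Perm.coe_mul]
    constructor
    · intro h
      rw [h]
    · intro h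
      funext x
      have := congr_fun h (π.symm x)
      simpa using this
  exact if_congr hiff rfl rfl

/-- **The Chow tensor is invariant under relabelling the alphabet.** [folklore] -/
private theorem chowTensor_relabel (ρ : Equiv.Perm (Fin m)) (j : Fin m → Fin m) :
    chowTensor m (ρ ∘ j) = chowTensor m j := by
  rw [chowTensor_apply, chowTensor_apply]
  congr 1
  symm
  -- reindex `τ ↦ ρ * τ`
  refine Fintype.sum_equiv (Equiv.mulLeft ρ) _ _ fun τ => ?_
  have hiff : j = ⇑τ ↔ ρ ∘ j = ⇑(Equiv.mulLeft ρ τ) := by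
    rw [Equiv.coe_mulLeft, Equiv.Perm.coe_mul]
    constructor
    · intro h
      rw [h]
    · intro h
      exact (ρ.injective.comp_left h)
  exact if_congr hiff rfl rfl

/-- **The support of the Chow tensor is rigid**: two permutations agreeing off one slot agree.
[folklore] -/
private theorem chowTensor_rigid (j : Fin m → Fin m) (k : Fin m) (b : Fin m)
    (hj : chowTensor m j ≠ 0) (hj' : chowTensor m (Function.update j k b) ≠ 0) : b = j k := by
  obtain ⟨τ, rfl⟩ := exists_eq_perm_of_chowTensor_ne_zero hj
  obtain ⟨τ', hτ'⟩ := exists_eq_perm_of_chowTensor_ne_zero hj'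
  have hττ' : τ = τ' := Equiv.Perm.eq_of_apply_eq_off_one τ τ' k fun x hx => by
    have := congr_fun hτ' x
    rwa [Function.update_of_ne hx] at this
  subst hττ'
  have := congr_fun hτ' k
  rwa [Function.update_self] at this

/-- **The polynomial shadow of the Chow tensor is `X₁⋯X_m`** (the `m!` bijective words all carry
the monomial `X₁⋯X_m`); the tensor model of the form `w = X₁⋯X_m` of Cor. 2.9 (intermediate step of
this file's proof; the identity itself is not printed in the source).
[cite: BurgisserIkenmeyer2017, Cor. 2.9 (proof, `w = X₁⋯X_m`; held p0007.txt:L44–46)] -/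
theorem tensorToPoly_chowTensor (m : ℕ) :
    tensorToPoly (chowTensor m) = ∏ i : Fin m, (X i : MvPolynomial (Fin m) ℂ) := by
  rw [tensorToPoly_apply]
  have hexp : ∀ j : Fin m → Fin m,
      C (chowTensor m j) * ∏ k, (X (j k) : MvPolynomial (Fin m) ℂ) =
        ∑ τ : Equiv.Perm (Fin m),
          if j = ⇑τ then C ((Nat.factorial m : ℂ)⁻¹) * ∏ k, (X (j k) : MvPolynomial (Fin m) ℂ)
          else 0 := by
    intro j
    rw [chowTensor_apply, map_mul, map_sum, Finset.mul_sum, Finset.sum_mul]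
    refine Finset.sum_congr rfl fun τ _ => ?_
    by_cases h : j = ⇑τ
    · rw [if_pos h, if_pos h, map_one, mul_one]
    · rw [if_neg h, if_neg h, map_zero, mul_zero, zero_mul]
  simp_rw [hexp]
  rw [Finset.sum_comm]
  have hin : ∀ τ : Equiv.Perm (Fin m),
      (∑ j : Fin m → Fin m,
        if j = ⇑τ then C ((Nat.factorial m : ℂ)⁻¹) * ∏ k, (X (j k) : MvPolynomial (Fin m) ℂ)
        else 0) =
        C ((Nat.factorial m : ℂ)⁻¹) * ∏ i, (X i : MvPolynomial (Fin m) ℂ) := by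
    intro τ
    rw [Finset.sum_ite_eq' Finset.univ (⇑τ), if_pos (Finset.mem_univ _)]
    congr 1
    exact Equiv.prod_comp τ (fun i => (X i : MvPolynomial (Fin m) ℂ))
  simp_rw [hin]
  rw [Finset.sum_const, Finset.card_univ, Fintype.card_perm, Fintype.card_fin, nsmul_eq_mul,
    ← mul_assoc, ← map_natCast (C : ℂ →+* MvPolynomial (Fin m) ℂ), ← map_mul,
    mul_inv_cancel₀ (Nat.cast_ne_zero.mpr (Nat.factorial_ne_zero m)), map_one, one_mul]

/-- **`X₁⋯X_m` is polystable** (Bürgisser–Ikenmeyer 2017, Cor. 2.9, first clause), by the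
Kempf–Ness route. [cite: BurgisserIkenmeyer2017, Cor. 2.9] -/
theorem isPolystable_prod_X (m : ℕ) :
    IsPolystable (∏ i : Fin m, X i : MvPolynomial (Fin m) ℂ) := by
  rw [← tensorToPoly_chowTensor m]
  exact isPolystable_tensorToPoly_of_rigid_of_relabel (chowTensor m) chowTensor_comp_perm
    chowTensor_rigid chowTensor_relabel

end Chow

/-! ### The power sum `X₁^D + ⋯ + X_m^D` as a symmetric tensor -/

section PowerSum

variable {m D : ℕ}

/-- The **power-sum tensor**: the symmetric `D`-tensor on `Fin m` supported on the constant words,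
`powerSumTensor m D j = ∑_i [j = (i,…,i)]`, whose polynomial shadow is `X₁^D + ⋯ + X_m^D`
(`tensorToPoly_powerSumTensor`). [folklore] -/
def powerSumTensor (m D : ℕ) : (Fin D → Fin m) → ℂ :=
  fun j => ∑ i : Fin m, if j = (fun _ => i) then 1 else 0

/-- Unfolding `powerSumTensor`. [folklore] -/
private theorem powerSumTensor_apply (j : Fin D → Fin m) :
    powerSumTensor m D j = ∑ i : Fin m, if j = (fun _ => i) then 1 else 0 :=
  rfl

/-- A word in the support of the power-sum tensor is constant. [folklore] -/
private theorem exists_eq_const_of_powerSumTensor_ne_zero {j : Fin D → Fin m}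
    (hj : powerSumTensor m D j ≠ 0) : ∃ i : Fin m, j = fun _ => i := by
  by_contra h
  refine hj ?_
  rw [powerSumTensor_apply, Finset.sum_eq_zero fun i _ => if_neg fun hi => h ⟨i, hi⟩]

/-- **The power-sum tensor is symmetric** under permutations of the slots. [folklore] -/
private theorem powerSumTensor_comp_perm (π : Equiv.Perm (Fin D)) (j : Fin D → Fin m) :
    powerSumTensor m D (j ∘ π) = powerSumTensor m D j := by
  rw [powerSumTensor_apply, powerSumTensor_apply]
  refine Finset.sum_congr rfl fun i _ => ?_
  have hiff : (j ∘ π = fun _ => i) ↔ (j = fun _ => i) := by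
    constructor
    · intro h
      funext x
      have := congr_fun h (π.symm x)
      simpa using this
    · intro h
      rw [h]
      rfl
  exact if_congr hiff rfl rfl

/-- **The power-sum tensor is invariant under relabelling the alphabet.** [folklore] -/
private theorem powerSumTensor_relabel (ρ : Equiv.Perm (Fin m)) (j : Fin D → Fin m) :
    powerSumTensor m D (ρ ∘ j) = powerSumTensor m D j := by
  rw [powerSumTensor_apply, powerSumTensor_apply]
  symm
  -- reindex `i ↦ ρ i`
  refine Fintype.sum_equiv ρ _ _ fun i => ?_
  have hiff : (j = fun _ => i) ↔ (ρ ∘ j = fun _ => ρ i) := by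
    constructor
    · intro h
      rw [h]
      rfl
    · intro h
      exact ρ.injective.comp_left h
  exact if_congr hiff rfl rfl

/-- **The support of the power-sum tensor is rigid for `D ≥ 2`**: two constant words of length
`≥ 2` agreeing off one slot agree. (For `D = 1` this fails — and indeed a linear form in `m ≥ 2`
variables is not polystable.) [folklore] -/
private theorem powerSumTensor_rigid (hD : 2 ≤ D) (j : Fin D → Fin m) (k : Fin D) (b : Fin m)
    (hj : powerSumTensor m D j ≠ 0) (hj' : powerSumTensor m D (Function.update j k b) ≠ 0) :
    b = j k := by
  obtain ⟨i, rfl⟩ := exists_eq_const_of_powerSumTensor_ne_zero hj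
  obtain ⟨i', hi'⟩ := exists_eq_const_of_powerSumTensor_ne_zero hj'
  haveI : Nontrivial (Fin D) := Fin.nontrivial_iff_two_le.mpr hD
  obtain ⟨k', hk'⟩ := exists_ne k
  have h1 : i = i' := by
    have := congr_fun hi' k'
    rwa [Function.update_of_ne hk'] at this
  have h2 : b = i' := by
    have := congr_fun hi' k
    rwa [Function.update_self] at this
  rw [h2, ← h1]

/-- **The polynomial shadow of the power-sum tensor is `X₁^D + ⋯ + X_m^D`**; the tensor model of the
form `X₁^D + ⋯ + X_m^D` of Cor. 2.9 (intermediate step of this file's proof; the identity itself is not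
printed in the source). [cite: BurgisserIkenmeyer2017, Cor. 2.9 (proof, `X₁^D + ⋯ + X_m^D`; held p0007.txt:L47–51)] -/
theorem tensorToPoly_powerSumTensor (m D : ℕ) :
    tensorToPoly (powerSumTensor m D) = ∑ i : Fin m, (X i ^ D : MvPolynomial (Fin m) ℂ) := by
  rw [tensorToPoly_apply]
  have hexp : ∀ j : Fin D → Fin m,
      C (powerSumTensor m D j) * ∏ k, (X (j k) : MvPolynomial (Fin m) ℂ) =
        ∑ i : Fin m, if j = (fun _ => i) then ∏ k, (X (j k) : MvPolynomial (Fin m) ℂ) else 0 := by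
    intro j
    rw [powerSumTensor_apply, map_sum, Finset.sum_mul]
    refine Finset.sum_congr rfl fun i _ => ?_
    by_cases h : j = fun _ => i
    · rw [if_pos h, if_pos h, map_one, one_mul]
    · rw [if_neg h, if_neg h, map_zero, zero_mul]
  simp_rw [hexp]
  rw [Finset.sum_comm]
  refine Finset.sum_congr rfl fun i _ => ?_
  rw [Finset.sum_ite_eq' Finset.univ (fun _ : Fin D => i), if_pos (Finset.mem_univ _),
    Fin.prod_const]

/-- **`X₁^D + ⋯ + X_m^D` is polystable for `D > 1`** (Bürgisser–Ikenmeyer 2017, Cor. 2.9, second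
clause), by the Kempf–Ness route. [cite: BurgisserIkenmeyer2017, Cor. 2.9] -/
theorem isPolystable_sum_X_pow (m : ℕ) {D : ℕ} (hD : 1 < D) :
    IsPolystable (∑ i : Fin m, X i ^ D : MvPolynomial (Fin m) ℂ) := by
  rw [← tensorToPoly_powerSumTensor m D]
  exact isPolystable_tensorToPoly_of_rigid_of_relabel (powerSumTensor m D) powerSumTensor_comp_perm
    (powerSumTensor_rigid hD) powerSumTensor_relabel

end PowerSum

/-! ### Assembly -/

/-- **Bürgisser–Ikenmeyer 2017, Corollary 2.9 (the clauses `X₁⋯X_m` and `X₁^D + ⋯ + X_m^D`,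
`D > 1`), discharged**: both forms are polystable. Together with
`BurgisserIkenmeyer2017_polystable_det_per_holds` (`det_n`, `per_n`) this is the whole of Cor. 2.9.
The printed proof (Prop. 2.8 with the diagonal torus / the `D`-th roots of unity, and `(1,…,1)` in
the cone of the support) is replaced by the Kempf–Ness route of `PolystabilityProofs.lean`: the two
forms are polynomial shadows of symmetric tensors with rigid, relabelling-invariant support, hence
with scalar moment matrix, hence with closed `SL`-orbit. [cite: BurgisserIkenmeyer2017, Cor. 2.9] -/
theorem BI2017_cor_2_9_chow_powerSum_holds : BI2017_cor_2_9_chow_powerSum :=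
  ⟨isPolystable_prod_X, fun m _ hD => isPolystable_sum_X_pow m hD⟩

/-! ### The pencil of the Fermat form and the Chow form (`m ≥ 3`) -/

section FermatChowPencil

variable {m : ℕ}

/-- Two slots off a given one, when `m ≥ 3`. [folklore] -/
private theorem exists_ne_ne_of_three_le (hm : 3 ≤ m) (k : Fin m) :
    ∃ x₁ x₂ : Fin m, x₁ ≠ x₂ ∧ x₁ ≠ k ∧ x₂ ≠ k := by
  have hcard : 1 < (Finset.univ.erase k).card := by
    rw [Finset.card_erase_of_mem (Finset.mem_univ k), Finset.card_univ, Fintype.card_fin]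
    omega
  obtain ⟨a, ha, b, hb, hab⟩ := Finset.one_lt_card.mp hcard
  exact ⟨a, b, hab, Finset.ne_of_mem_erase ha, Finset.ne_of_mem_erase hb⟩

/-- For `m ≥ 3` a constant word and a bijective word never differ in only one slot. [folklore] -/
private theorem const_ne_perm_off_one (hm : 3 ≤ m) (i : Fin m) (τ : Equiv.Perm (Fin m)) (k : Fin m)
    (h : ∀ x, x ≠ k → (τ : Fin m → Fin m) x = i) : False := by
  obtain ⟨x₁, x₂, h12, h1, h2⟩ := exists_ne_ne_of_three_le hm k
  exact h12 (τ.injective ((h x₁ h1).trans (h x₂ h2).symm))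

/-- **The support of `p · Fermat + e · Chow` is rigid for `m ≥ 3`**: the support words are the
constant and the bijective words; two of the same kind differing in one slot agree there
(`powerSumTensor_rigid`, `chowTensor_rigid`), and two of different kinds differ in at least two slots.
[folklore] -/
private theorem fermatChow_rigid (hm : 3 ≤ m) (p e : ℂ) (j : Fin m → Fin m) (k : Fin m) (b : Fin m)
    (hj : (p • powerSumTensor m m + e • chowTensor m) j ≠ 0)
    (hj' : (p • powerSumTensor m m + e • chowTensor m) (Function.update j k b) ≠ 0) : b = j k := by
  have hcases : ∀ {w : Fin m → Fin m}, (p • powerSumTensor m m + e • chowTensor m) w ≠ 0 →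
      powerSumTensor m m w ≠ 0 ∨ chowTensor m w ≠ 0 := by
    intro w hw
    by_contra h
    push Not at h
    apply hw
    simp only [Pi.add_apply, Pi.smul_apply, smul_eq_mul, h.1, h.2, mul_zero, add_zero]
  rcases hcases hj with h1 | h1 <;> rcases hcases hj' with h2 | h2
  · exact powerSumTensor_rigid (by omega) j k b h1 h2
  · obtain ⟨i, rfl⟩ := exists_eq_const_of_powerSumTensor_ne_zero h1
    obtain ⟨τ, hτ⟩ := exists_eq_perm_of_chowTensor_ne_zero h2
    exact (const_ne_perm_off_one hm i τ k fun x hx => by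
      rw [← hτ, Function.update_of_ne hx]).elim
  · obtain ⟨τ, rfl⟩ := exists_eq_perm_of_chowTensor_ne_zero h1
    obtain ⟨i, hi⟩ := exists_eq_const_of_powerSumTensor_ne_zero h2
    exact (const_ne_perm_off_one hm i τ k fun x hx => by
      have := congr_fun hi x
      rwa [Function.update_of_ne hx] at this).elim
  · exact chowTensor_rigid j k b h1 h2

/-- **The pencil spanned by the Fermat form `X₁^m + ⋯ + X_m^m` and the Chow form `X₁⋯X_m` consists
of polystable forms (`m ≥ 3`)** — for `m = 3` this is the Hesse pencil `x³ + y³ + z³ + t·xyz`. Both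
clauses of BI 2017 Cor. 2.9 (`p = 0` or `e = 0`) at once, by the same Kempf–Ness route: the symmetric
tensor `p · powerSumTensor + e · chowTensor` has rigid, relabelling-invariant support (OUR companion
statement in the style of the printed proof of Cor. 2.9 via Prop. 2.8; not a sentence of the source).
For `m = 2` the statement is false (`(x + y)² = x² + 2xy + y²` is not polystable) and rigidity fails.
[cite: BurgisserIkenmeyer2017, Cor. 2.9 (proof) and Prop. 2.8] -/
theorem isPolystable_fermat_add_chow (hm : 3 ≤ m) (p e : ℂ) :
    IsPolystable (C p * (∑ i : Fin m, X i ^ m) + C e * ∏ i : Fin m, X i : MvPolynomial (Fin m) ℂ) := by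
  have h := isPolystable_tensorToPoly_of_rigid_of_relabel (p • powerSumTensor m m + e • chowTensor m)
    (fun π j => by
      simp only [Pi.add_apply, Pi.smul_apply, powerSumTensor_comp_perm, chowTensor_comp_perm])
    (fermatChow_rigid hm p e)
    (fun ρ j => by
      simp only [Pi.add_apply, Pi.smul_apply, powerSumTensor_relabel, chowTensor_relabel])
  rwa [tensorToPoly_add, tensorToPoly_smul, tensorToPoly_smul, tensorToPoly_powerSumTensor,
    tensorToPoly_chowTensor, smul_eq_C_mul, smul_eq_C_mul] at h

end FermatChowPencil

end Literature.Computability.AlgebraicComplexity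

end
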